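import Summits.MatrixMultiplication.MatrixMultiplication.Theorems.SoloInformedSpreadTranslate
import Summits.MatrixMultiplication.MatrixMultiplication.Theorems.SoloInformedCrossStar

/-!
# A doubly-rich spread base slice forces rank ≥ n³/3 (THEOREM 8.22, case (α1), kernel form)

This work, §8.8 (T13) / paper `C3-m2.md` §§3–4 (gen 107). Setting of `SoloInformedTranslateWorld` /
`SoloInformedSpreadTranslate` [CohnUmans2013, arXiv:1207.6528, Def. 12; coprime case, every chart].

* `card_image_sym2_ge_five` — RICHNESS FEEDS LEMMA CI′: if `x_i + y_i` takes `≥ 17` values then the family of class pairs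
  `{[x_i], [y_i]}` has `≥ 5` distinct members (a member determines `x_i + y_i` up to four sign choices).
* `Data.cube_le_three_mul_of_rich_spread` — if column `j₀` of `a` and row `j₀` of `b` each take `≥ 17` values (so every
  column / row is EXACTLY LOCKED to it, `Data.locked_of_cross_rich`) and have class multiplicity `≤ μ`, `10 μ < n`, then
  `n³ ≤ 3 · r · |S⁰|` (`Data.cube_le_three_mul_of_spread`). This is case (α1) of THEOREM 8.22 (= CONJECTURE C3 for
  `m = 2` coprime), entirely kernel-checked.
References: this work §8.8 (T13); CohnUmans2013 Def. 12.
-/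

namespace Summit.MatrixMultiplication.MatrixMultiplication.Theorems.TwistedTPP

namespace FibreLines

variable {ι G : Type*} [AddCommGroup G]

/-- Without 2-torsion, doubling is injective. -/
theorem add_self_injective (hG : ∀ x : G, x = -x → x = 0) : Function.Injective fun x : G => x + x := by
  intro x y h
  simp only at h
  have e : (x - y) + (x - y) = (x + x) - (y + y) := by abel
  have h0 : x - y = 0 := eq_zero_of_add_self_eq_zero hG (by rw [e, h, sub_self])
  exact sub_eq_zero.mp h0

/-- **Richness feeds Lemma CI′.** If `x_i + y_i` takes at least `17` values, the family of class pairs `{[x_i],[y_i]}` has at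
least five distinct members. [this work, §8.8 (T13)(a); `C3-m2.md` §3] -/
theorem card_image_sym2_ge_five [Fintype ι] [DecidableEq ι] [DecidableEq G] {R : Type*} [DecidableEq R]
    (κ : G → R) (hκ : ∀ x y, κ x = κ y → SignEq x y) (x y : ι → G)
    (h17 : 17 ≤ ((Finset.univ : Finset ι).image fun i => x i + y i).card) :
    5 ≤ ((Finset.univ : Finset ι).image fun i => s(κ (x i), κ (y i))).card := by
  by_contra hlt
  push Not at hlt
  set M : Finset (Sym2 R) := (Finset.univ : Finset ι).image fun i => s(κ (x i), κ (y i)) with hM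
  have cover : ((Finset.univ : Finset ι).image fun i => x i + y i) ⊆
      M.biUnion (fun mm => ((Finset.univ : Finset ι).filter fun i => s(κ (x i), κ (y i)) = mm).image
        fun i => x i + y i) := by
    intro v hv
    obtain ⟨i, -, rfl⟩ := Finset.mem_image.mp hv
    refine Finset.mem_biUnion.mpr ⟨s(κ (x i), κ (y i)), Finset.mem_image.mpr ⟨i, Finset.mem_univ _, rfl⟩, ?_⟩
    exact Finset.mem_image.mpr ⟨i, by simp, rfl⟩
  have part : ∀ mm ∈ M, (((Finset.univ : Finset ι).filter fun i => s(κ (x i), κ (y i)) = mm).image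
      fun i => x i + y i).card ≤ 4 := by
    intro mm hmm
    obtain ⟨i', -, rfl⟩ := Finset.mem_image.mp hmm
    calc _ ≤ ({x i' + y i', x i' + -y i', -x i' + y i', -x i' + -y i'} : Finset G).card := by
          apply Finset.card_le_card
          intro v hv
          obtain ⟨i, hi, rfl⟩ := Finset.mem_image.mp hv
          simp only [Finset.mem_filter, Finset.mem_univ, true_and] at hi
          simp only [Finset.mem_insert, Finset.mem_singleton]
          rcases Sym2.eq_iff.mp hi with ⟨h₁, h₂⟩ | ⟨h₁, h₂⟩ <;>
            rcases hκ _ _ h₁ with e₁ | e₁ <;> rcases hκ _ _ h₂ with e₂ | e₂ <;> rw [e₁, e₂] <;>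
            first
              | (left; abel1)
              | (right; left; abel1)
              | (right; right; left; abel1)
              | (right; right; right; abel1)
      _ ≤ 4 := Finset.card_le_four
  have h1 := Finset.card_le_card cover
  have h2 := Finset.card_biUnion_le (s := M)
    (t := fun mm => ((Finset.univ : Finset ι).filter fun i => s(κ (x i), κ (y i)) = mm).image fun i => x i + y i)
  have h3 := Finset.sum_le_card_nsmul M _ 4 part
  simp only [smul_eq_mul] at h3
  have h4 : M.card * 4 ≤ 16 := by
    have : M.card ≤ 4 := Nat.lt_succ_iff.mp hlt
    omega
  omega

/-- **THEOREM 8.22, case (α1), in the kernel.** A doubly-rich base slice `j₀` (column of `a` and row of `b` with `≥ 17` values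
each) of small class multiplicity (`≤ μ`, `10 μ < n`) forces `n³ ≤ 3 · r · |S⁰|`. [this work, §8.8 (T13); `C3-m2.md` §§3–4] -/
theorem Data.cube_le_three_mul_of_rich_spread [Fintype ι] [DecidableEq ι] {G₀ : Type*} [AddCommGroup G₀] [Fintype G₀]
    [DecidableEq G₀] [Fintype G] [DecidableEq G] {R : Type*} [Fintype R] [DecidableEq R]
    (hG : ∀ x : G, x = -x → x = 0) (D : Data ι G) (Φ : Chart ι G₀) (κ : G → R)
    (hκ : ∀ x y, κ x = κ y ↔ SignEq x y) (hsep : D.SepAll Φ) (j₀ : ι)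
    (hra : 17 ≤ ((Finset.univ : Finset ι).image fun i => D.a i j₀).card)
    (hrb : 17 ≤ ((Finset.univ : Finset ι).image fun k => D.b j₀ k).card)
    (μ : ℕ) (hn : 10 * μ < Fintype.card ι)
    (hfμ : ∀ v : G, (Finset.univ.filter fun i => D.a i j₀ = v ∨ D.a i j₀ = -v).card ≤ μ)
    (hlμ : ∀ v : G, (Finset.univ.filter fun k => D.b j₀ k = v ∨ D.b j₀ k = -v).card ≤ μ) :
    Fintype.card ι ^ 3 ≤ 3 * (Fintype.card R * Fintype.card G₀) := by
  classical
  have key : ∀ j, ∃ t : G, (∀ i, SignEq (D.a i j) (D.a i j₀ + t) ∨ SignEq (D.a i j) (D.a i j₀ - t)) ∧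
      (∀ k, SignEq (D.b j k) (D.b j₀ k + t) ∨ SignEq (D.b j k) (D.b j₀ k - t)) := by
    intro j
    apply D.locked_of_cross_rich κ hκ j₀ j
    · refine card_image_sym2_ge_five κ (fun x y => (hκ x y).mp) (fun i => D.a i j₀ + D.a i j)
        (fun i => D.a i j₀ - D.a i j) ?_
      have e : (fun i => D.a i j₀ + D.a i j + (D.a i j₀ - D.a i j)) = (fun x : G => x + x) ∘ (fun i => D.a i j₀) := by
        funext i; simp only [Function.comp_apply]; abel
      rw [e, ← Finset.image_image, Finset.card_image_of_injective _ (add_self_injective hG)]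
      exact hra
    · refine card_image_sym2_ge_five κ (fun x y => (hκ x y).mp) (fun k => D.b j₀ k + D.b j k)
        (fun k => D.b j₀ k - D.b j k) ?_
      have e : (fun k => D.b j₀ k + D.b j k + (D.b j₀ k - D.b j k)) = (fun x : G => x + x) ∘ (fun k => D.b j₀ k) := by
        funext k; simp only [Function.comp_apply]; abel
      rw [e, ← Finset.image_image, Finset.card_image_of_injective _ (add_self_injective hG)]
      exact hrb
  choose t ht using key
  exact D.cube_le_three_mul_of_spread hG Φ κ (fun x y => (hκ x y).mp) hsep j₀ t (fun i j => (ht j).1 i)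
    (fun j k => (ht j).2 k) μ hn hfμ hlμ

end FibreLines

end Summit.MatrixMultiplication.MatrixMultiplication.Theorems.TwistedTPP
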